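import Literature.NumberTheory.Sieve.Maynard2016Prop92Support
import Literature.NumberTheory.Sieve.Maynard2016Prop92ErrorTools
import Literature.NumberTheory.Sieve.Maynard2016Lemma85
import Literature.NumberTheory.Sieve.FGKMT2018MainTermPrefactor
import Literature.NumberTheory.Sieve.FGKMT2018Section8Toolbox
import HarnessLib

/-!
# Maynard 2016, Proposition 9.2 over `𝒜 = ℤ`: the error part

Source: J. Maynard, *Dense clusters of primes in subsets*, Compositio Math. 152 (2016) =
arXiv:1405.2593 [Maynard2016DenseClusters], proof of Proposition 9.2 p. 21: «The contribution from
$E(q,a)$ can be bounded by (2) in an identical manner to how we bounded the error terms in the proof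
of Proposition 9.1 by Hypothesis 1. … these error terms contribute a total of
$O(\#\mathcal{A}(x)/(W(\log x)^{2k^2}))$, which is negligible»; the pattern is the proof of
Proposition 9.1 p. 19 (fibre count `τ_{3k}(q)`, Cauchy–Schwarz, trivial bound for the first factor,
Hypothesis 1 for the second). K. Ford, B. Green, S. Konyagin, J. Maynard, T. Tao, *Long gaps between
primes*, JAMS 31 (2018) = arXiv:1412.5029v4 [FordGreenKonyaginMaynardTao2018], Theorem 6 pp. 21–22.

PROVED here (no named facts): **`maynard2016Prop92ErrorPart_holds :
Literature.NumberTheory.Sieve.Maynard2016Prop92ErrorPart`** — in the frame of [FGKMT, Thm 6],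
for `(a_m, B) = 1`, `L_m(n) > R` on `𝒜(X)` and Hypothesis 1 (2) at level `X^{1/3}` with constant `C_H`,
`|∑_{n ∈ 𝒜(X)} 1_𝒫(L_m(n)) w_n − φ_ω(W) (#𝒫_{L_m}(X)/φ_{L_m}(W)) Q_m| ≤ K · errTermB`
(`K = 4 √(3 C_H) · 8 + 1`). Chain: the exact split `sum_prime_sieveWt_eq_main_add_error`
(`Maynard2016Prop92Support`); per pair, the class errors are `≤ φ_ω(W) E*_q` (`abs_sum_pairClasses_err_le`);
`|λ_d| ≤ Λ = 2(2e⁵ log R)^k` (Lemma 8.5 (i), `maynard_lemma85i_frame`) and the support `∏ dᵢ < R`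
reduce to `Λ² φ_ω(W) ∑_{(d,e)} E*_{W∏[dᵢ,eᵢ]}` (`abs_esum_le`); Cauchy–Schwarz over the fibres of
`(d, e) ↦ ∏[dᵢ, eᵢ]` (`Maynard2016Prop92ErrorTools`), the fibre bound `(4(k+1))^{ω}`, the trivial bound
`E*_q ≤ 3#𝒜/φ(q)`, the divisor sum `≤ (e⁵ log R²)^{16(k+1)²}` and Hypothesis 1 (2)
(`∑ E*_q ≤ C_H #𝒫/(log X)^{100k²}`); finally `errTermB ≥ e^{−7k} #𝒜 (2k log k)^{−k}/8`
([Maynard, Lemmas 8.1, 8.6]: `exp_neg_seven_mul_le_singSeriesExcl`, `MaynardDense.exists_IF_JF_bounds`)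
and `(log X)^{−11k²} ≤ e^{−7k}(2k log k)^{−k}` in the regime `k ≤ (log x)^{1/5}` (`prop92err_arith`).

## References
* J. Maynard, *Dense clusters of primes in subsets*, Compositio Math. 152 (2016), proofs of
  Props. 9.1, 9.2 pp. 19–21, Lemmas 8.1, 8.5, 8.6 [Maynard2016DenseClusters].
* K. Ford, B. Green, S. Konyagin, J. Maynard, T. Tao, *Long gaps between primes*, JAMS 31 (2018),
  Thm 6 and §7 [FordGreenKonyaginMaynardTao2018].
-/

noncomputable section

open Finset Filter Topology

namespace Literature.NumberTheory.Sieve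

namespace FGKMT2018

variable {k : ℕ}

/-! ### Per pair: the class errors are `≤ φ_ω(W) E*_q` -/

/-- For `d, e ∈ 𝒟'_k` with `d_m = e_m = 1`, cross-coprime, and a maximising class choice `a`:
`|∑_{c ∈ classes(d,e)} (#𝒫_{L_m}(X; q, c) − #𝒫_{L_m}(X)/φ_{L_m}(q))| ≤ φ_ω(W) · E*_q`, `q = W∏[dᵢ,eᵢ]`.
[cite: Maynard2016DenseClusters, proof of Prop. 9.2 p. 21 («#𝒫_{L,𝒜}(x;q,a) = #𝒫_{L,𝒜}(x)/φ_L(q) + O(E(q,a))»)] -/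
theorem abs_sum_pairClasses_err_le (X : ℝ) {L : Fin k → ℤ × ℤ} (hadm : FormsAdmissible L) {B : ℕ}
    {R : ℝ} (m : Fin k) {a : ℕ → ℕ}
    (ha : ∀ q c : ℕ, c < q → Int.gcd (formEval (L m) c) q = 1 →
      Int.gcd (formEval (L m) (a q)) q = 1 ∧ classErr (L m) X q c ≤ classErr (L m) X q (a q))
    {d e : Fin k → ℕ} (hd : d ∈ dkBoxP L B R m) (he : e ∈ dkBoxP L B R m)
    (hx : ∀ i j, i ≠ j → (d i * e i).Coprime (d j * e j)) :
    |∑ c ∈ pairClasses L B d e, ((primeCountZMod (L m) X (pairMod B d e) c : ℝ) -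
        primeCountZ (L m) X / totForm (L m) (pairMod B d e))| ≤
      phiOmega L (wCut k B) * errStar (L m) X a (pairMod B d e) := by
  classical
  have hdB := dkBoxP_subset L B R m hd
  have heB := dkBoxP_subset L B R m he
  have hP : Pairwise fun i j => (d i * e i).Coprime (d j * e j) := fun i j hij => hx i j hij
  refine (Finset.abs_sum_le_sum_abs _ _).trans ?_
  have hle : ∀ c ∈ pairClasses L B d e, |((primeCountZMod (L m) X (pairMod B d e) c : ℝ) -
      primeCountZ (L m) X / totForm (L m) (pairMod B d e))| ≤ errStar (L m) X a (pairMod B d e) := by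
    intro c hc
    have hcq : c < pairMod B d e := by
      have h := (Finset.mem_filter.1 hc).1
      exact Finset.mem_range.1 h
    exact classErr_le_errStar ha hcq (intGcd_formEval_eq_one_of_mem_pairClasses hd he hc)
  refine (Finset.sum_le_sum hle).trans ?_
  rw [Finset.sum_const, nsmul_eq_mul, card_pairClasses_eq hadm hdB heB hP]

/-! ### The sum over pairs: `≤ Λ² φ_ω(W) ∑_{(d,e)} E*_{q(d,e)}` -/

/-- The support box `{d ∈ 𝒟_k : ∏ dᵢ < R}` (outside it `λ_d = 0`).
[cite: Maynard2016DenseClusters, proof of Prop. 9.1 p. 19 («λ_d is supported on d < R»)] -/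
def lamSuppBox (L : Fin k → ℤ × ℤ) (B : ℕ) (R : ℝ) : Finset (Fin k → ℕ) :=
  (dkBox L B R).filter fun d => (∏ i, (d i : ℝ)) < R

/-- The cross-coprime pairs of the support box.
[cite: Maynard2016DenseClusters, proof of Prop. 9.1 p. 19 («no contribution unless (d_ie_i,d_je_j)=1»)] -/
def crossPairSet (L : Fin k → ℤ × ℤ) (B : ℕ) (R : ℝ) : Finset ((Fin k → ℕ) × (Fin k → ℕ)) :=
  (lamSuppBox L B R ×ˢ lamSuppBox L B R).filter fun pr =>
    ∀ i j, i ≠ j → (pr.1 i * pr.2 i).Coprime (pr.1 j * pr.2 j)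

/-- The support box lies in `𝒟_k`. [cite: Maynard2016DenseClusters, proof of Prop. 9.1 p. 19] -/
theorem lamSuppBox_subset (L : Fin k → ℤ × ℤ) (B : ℕ) (R : ℝ) : lamSuppBox L B R ⊆ dkBox L B R :=
  Finset.filter_subset _ _

/-- Membership in the pair set. [cite: Maynard2016DenseClusters, proof of Prop. 9.1 p. 19] -/
theorem mem_crossPairSet_iff {L : Fin k → ℤ × ℤ} {B : ℕ} {R : ℝ} {pr : (Fin k → ℕ) × (Fin k → ℕ)} :
    pr ∈ crossPairSet L B R ↔ (pr.1 ∈ dkBox L B R ∧ (∏ i, (pr.1 i : ℝ)) < R) ∧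
      (pr.2 ∈ dkBox L B R ∧ (∏ i, (pr.2 i : ℝ)) < R) ∧
        ∀ i j, i ≠ j → (pr.1 i * pr.2 i).Coprime (pr.1 j * pr.2 j) := by
  unfold crossPairSet lamSuppBox
  simp only [Finset.mem_filter, Finset.mem_product, and_assoc]

/-- **The error over all pairs**: with `|λ_d| ≤ Λ` and a maximising class choice,
`|∑'_{d,e ∈ 𝒟'_k, d_m=e_m=1} λ_dλ_e ∑_c (#𝒫(X;q,c) − #𝒫(X)/φ_L(q))| ≤ Λ² φ_ω(W) ∑_{(d,e) ∈ pairs} E*_{q(d,e)}`.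
[cite: Maynard2016DenseClusters, proof of Prop. 9.1 p. 19 («∑_{d,e}|λ_dλ_e| E_q ≪ (log x)^{2k} ∑_q μ²(q)τ_{3k}(q)E_q»), proof of Prop. 9.2 p. 21] -/
theorem abs_esum_le (X : ℝ) {L : Fin k → ℤ × ℤ} (hadm : FormsAdmissible L) (B : ℕ) {R : ℝ}
    (hR : 1 < R) (m : Fin k) {a : ℕ → ℕ}
    (ha : ∀ q c : ℕ, c < q → Int.gcd (formEval (L m) c) q = 1 →
      Int.gcd (formEval (L m) (a q)) q = 1 ∧ classErr (L m) X q c ≤ classErr (L m) X q (a q))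
    {Λ : ℝ} (hΛ0 : 0 ≤ Λ) (hΛ : ∀ d : Fin k → ℕ, |lamVar L B R (MaynardDense.F k) d| ≤ Λ) :
    |∑ d ∈ dkBoxP L B R m, ∑ e ∈ dkBoxP L B R m,
        (if ∀ i j, i ≠ j → (d i * e i).Coprime (d j * e j) then
          lamVar L B R (MaynardDense.F k) d * lamVar L B R (MaynardDense.F k) e *
            ∑ c ∈ pairClasses L B d e, ((primeCountZMod (L m) X (pairMod B d e) c : ℝ) -
              primeCountZ (L m) X / totForm (L m) (pairMod B d e))
        else 0)| ≤
      Λ ^ 2 * phiOmega L (wCut k B) *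
        ∑ pr ∈ crossPairSet L B R, errStar (L m) X a (pairMod B pr.1 pr.2) := by
  classical
  have hφ : 0 ≤ phiOmega L (wCut k B) := phiOmega_wCut_nonneg L B
  set g : (Fin k → ℕ) → (Fin k → ℕ) → ℝ := fun d e =>
    if ∀ i j, i ≠ j → (d i * e i).Coprime (d j * e j) then
      |lamVar L B R (MaynardDense.F k) d| * |lamVar L B R (MaynardDense.F k) e| *
        (phiOmega L (wCut k B) * errStar (L m) X a (pairMod B d e)) else 0 with hg
  have hg0 : ∀ d e, 0 ≤ g d e := fun d e => by
    simp only [hg]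
    split_ifs
    · exact mul_nonneg (mul_nonneg (abs_nonneg _) (abs_nonneg _))
        (mul_nonneg hφ (errStar_nonneg _ _ _ _))
    · exact le_rfl
  -- (a) termwise
  have h2a : |∑ d ∈ dkBoxP L B R m, ∑ e ∈ dkBoxP L B R m,
      (if ∀ i j, i ≠ j → (d i * e i).Coprime (d j * e j) then
        lamVar L B R (MaynardDense.F k) d * lamVar L B R (MaynardDense.F k) e *
          ∑ c ∈ pairClasses L B d e, ((primeCountZMod (L m) X (pairMod B d e) c : ℝ) -
            primeCountZ (L m) X / totForm (L m) (pairMod B d e))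
        else 0)| ≤ ∑ d ∈ dkBoxP L B R m, ∑ e ∈ dkBoxP L B R m, g d e := by
    refine (Finset.abs_sum_le_sum_abs _ _).trans (Finset.sum_le_sum fun d hd =>
      (Finset.abs_sum_le_sum_abs _ _).trans (Finset.sum_le_sum fun e he => ?_))
    simp only [hg]
    split_ifs with hx
    · rw [abs_mul, abs_mul]
      exact mul_le_mul_of_nonneg_left (abs_sum_pairClasses_err_le X hadm m ha hd he hx)
        (mul_nonneg (abs_nonneg _) (abs_nonneg _))
    · simp
  -- (b) extend to `𝒟_k × 𝒟_k`
  have h2b : ∑ d ∈ dkBoxP L B R m, ∑ e ∈ dkBoxP L B R m, g d e ≤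
      ∑ d ∈ dkBox L B R, ∑ e ∈ dkBox L B R, g d e := by
    have hsub := dkBoxP_subset L B R m
    calc ∑ d ∈ dkBoxP L B R m, ∑ e ∈ dkBoxP L B R m, g d e
        ≤ ∑ d ∈ dkBoxP L B R m, ∑ e ∈ dkBox L B R, g d e :=
          Finset.sum_le_sum fun d _ => Finset.sum_le_sum_of_subset_of_nonneg hsub
            fun e _ _ => hg0 d e
      _ ≤ ∑ d ∈ dkBox L B R, ∑ e ∈ dkBox L B R, g d e :=
          Finset.sum_le_sum_of_subset_of_nonneg hsub fun d _ _ =>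
            Finset.sum_nonneg fun e _ => hg0 d e
  -- (c) restrict to the support box
  have hvan : ∀ d, d ∈ dkBox L B R → d ∉ lamSuppBox L B R → lamVar L B R (MaynardDense.F k) d = 0 :=
    fun d hdB hd => by
      have : ¬ (∏ i, (d i : ℝ)) < R := fun h => hd (Finset.mem_filter.2 ⟨hdB, h⟩)
      exact lamVar_F_eq_zero_of_le_prod L B hR d (not_lt.1 this)
  have hsub : lamSuppBox L B R ⊆ dkBox L B R := lamSuppBox_subset L B R
  have h2c : ∑ d ∈ dkBox L B R, ∑ e ∈ dkBox L B R, g d e =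
      ∑ d ∈ lamSuppBox L B R, ∑ e ∈ lamSuppBox L B R, g d e := by
    symm
    rw [Finset.sum_subset hsub (fun d hdB hdn => ?_)]
    · refine Finset.sum_congr rfl fun d _ => Finset.sum_subset hsub fun e heB hen => ?_
      simp only [hg, hvan e heB hen, abs_zero, mul_zero, zero_mul, ite_self]
    · refine Finset.sum_eq_zero fun e _ => ?_
      simp only [hg, hvan d hdB hdn, abs_zero, zero_mul, ite_self]
  -- (d) `|λ_d||λ_e| ≤ Λ²`
  have h2d : ∑ d ∈ lamSuppBox L B R, ∑ e ∈ lamSuppBox L B R, g d e ≤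
      ∑ d ∈ lamSuppBox L B R, ∑ e ∈ lamSuppBox L B R,
        (if ∀ i j, i ≠ j → (d i * e i).Coprime (d j * e j) then
          Λ ^ 2 * (phiOmega L (wCut k B) * errStar (L m) X a (pairMod B d e)) else 0) := by
    refine Finset.sum_le_sum fun d _ => Finset.sum_le_sum fun e _ => ?_
    simp only [hg]
    split_ifs
    · refine mul_le_mul_of_nonneg_right ?_ (mul_nonneg hφ (errStar_nonneg _ _ _ _))
      rw [sq]
      exact mul_le_mul (hΛ d) (hΛ e) (abs_nonneg _) hΛ0
    · exact le_rfl
  -- (e) as a sum over the pair set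
  have h2e : ∑ d ∈ lamSuppBox L B R, ∑ e ∈ lamSuppBox L B R,
        (if ∀ i j, i ≠ j → (d i * e i).Coprime (d j * e j) then
          Λ ^ 2 * (phiOmega L (wCut k B) * errStar (L m) X a (pairMod B d e)) else 0) =
      Λ ^ 2 * phiOmega L (wCut k B) *
        ∑ pr ∈ crossPairSet L B R, errStar (L m) X a (pairMod B pr.1 pr.2) := by
    unfold crossPairSet
    rw [Finset.sum_filter, Finset.sum_product, Finset.mul_sum]
    refine Finset.sum_congr rfl fun d _ => ?_
    rw [Finset.mul_sum]
    refine Finset.sum_congr rfl fun e _ => ?_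
    dsimp only
    split_ifs <;> ring
  exact h2a.trans (h2b.trans (h2c.le.trans (h2d.trans h2e.le)))

/-! ### The two factors of the Cauchy–Schwarz step -/

/-- Facts about a pair in the pair set. [folklore] -/
private theorem crossPairSet_facts {L : Fin k → ℤ × ℤ} {B : ℕ} {R : ℝ}
    {pr : (Fin k → ℕ) × (Fin k → ℕ)} (hpr : pr ∈ crossPairSet L B R) :
    pr.1 ∈ dkBox L B R ∧ pr.2 ∈ dkBox L B R ∧
      (∀ i j, i ≠ j → (pr.1 i * pr.2 i).Coprime (pr.1 j * pr.2 j)) ∧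
      0 < ∏ i, Nat.lcm (pr.1 i) (pr.2 i) ∧
      ((∏ i, Nat.lcm (pr.1 i) (pr.2 i) : ℕ) : ℝ) < R ^ 2 ∧
      (∏ i, Nat.lcm (pr.1 i) (pr.2 i)).Coprime (wCut k B * B) := by
  obtain ⟨⟨hd, hdR⟩, ⟨he, heR⟩, hx⟩ := mem_crossPairSet_iff.1 hpr
  have hd1 := one_le_of_mem_dkBox hd
  have he1 := one_le_of_mem_dkBox he
  refine ⟨hd, he, hx, Finset.prod_pos fun i _ => Nat.lcm_pos (hd1 i) (he1 i), ?_, ?_⟩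
  · have hle : ((∏ i, Nat.lcm (pr.1 i) (pr.2 i) : ℕ) : ℝ) ≤
        (∏ i, (pr.1 i : ℝ)) * ∏ i, (pr.2 i : ℝ) := by
      have := prod_lcm_le_mul_prod pr.1 pr.2 hd1 he1
      exact_mod_cast this
    have h0 : 0 ≤ ∏ i, (pr.1 i : ℝ) := Finset.prod_nonneg fun i _ => Nat.cast_nonneg _
    calc ((∏ i, Nat.lcm (pr.1 i) (pr.2 i) : ℕ) : ℝ) ≤ (∏ i, (pr.1 i : ℝ)) * ∏ i, (pr.2 i : ℝ) := hle
      _ < R * R := mul_lt_mul'' hdR heR h0 (Finset.prod_nonneg fun i _ => Nat.cast_nonneg _)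
      _ = R ^ 2 := (sq R).symm
  · have h1 : (∏ i, Nat.lcm (pr.1 i) (pr.2 i)) ∣ (∏ i, pr.1 i) * ∏ i, pr.2 i := by
      rw [← Finset.prod_mul_distrib]
      exact Finset.prod_dvd_prod_of_dvd _ _ fun i _ => Nat.lcm_dvd_mul _ _
    exact Nat.Coprime.coprime_dvd_left h1
      (Nat.Coprime.mul_left (coprime_of_mem_dkBox hd) (coprime_of_mem_dkBox he))

/-- **The second factor** — Hypothesis 1 (2): the moduli `W∏[dᵢ,eᵢ]` of the pairs are distinct images
of `q' = ∏[dᵢ,eᵢ]`, squarefree, coprime to `B` and `≤ WR² ≤ X^{1/3}`, so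
`∑_{q'} E*_{Wq'} ≤ C_H #𝒫_{L_m}(X)/(log X)^{100k²}`.
[cite: Maynard2016DenseClusters, proof of Prop. 9.1 p. 19 («the average of E_q for the second sum»), proof of Prop. 9.2 p. 21 («bounded by (2)»)] -/
theorem sum_image_errStar_le_hyp {θ C_H : ℝ} {L : Fin k → ℤ × ℤ} {B : ℕ} {X R : ℝ}
    (m : Fin k) (a : ℕ → ℕ) (hH : HypothesisOneZ θ B k X (L m) C_H)
    (hWR : (wCut k B : ℝ) * R ^ 2 ≤ X ^ θ) :
    ∑ q ∈ (crossPairSet L B R).image (fun pr => ∏ i, Nat.lcm (pr.1 i) (pr.2 i)),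
        errStar (L m) X a (wCut k B * q) ≤
      C_H * primeCountZ (L m) X / Real.log X ^ (100 * k ^ 2) := by
  classical
  set I := (crossPairSet L B R).image (fun pr => ∏ i, Nat.lcm (pr.1 i) (pr.2 i)) with hI
  have hW0 : wCut k B ≠ 0 := (squarefree_wCut k B).ne_zero
  have hinj : Set.InjOn (fun q : ℕ => wCut k B * q) I :=
    fun x _ y _ h => Nat.eq_of_mul_eq_mul_left (Nat.pos_of_ne_zero hW0) h
  rw [show (∑ q ∈ I, errStar (L m) X a (wCut k B * q)) =
      ∑ q ∈ I.image (fun q : ℕ => wCut k B * q), errStar (L m) X a q from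
    (Finset.sum_image hinj).symm]
  refine le_trans (Finset.sum_le_sum_of_subset_of_nonneg (fun q hq => ?_)
    fun q _ _ => errStar_nonneg _ _ _ _) (sum_errStar_le_of_hypothesisOneZ hH a)
  obtain ⟨q', hq', rfl⟩ := Finset.mem_image.1 hq
  obtain ⟨pr, hpr, rfl⟩ := Finset.mem_image.1 hq'
  obtain ⟨-, -, -, hpos, hlt, hcop⟩ := crossPairSet_facts hpr
  have hW1 : 1 ≤ wCut k B := Nat.one_le_iff_ne_zero.2 hW0
  refine Finset.mem_filter.2 ⟨Finset.mem_Icc.2 ⟨?_, Nat.le_floor ?_⟩, ?_⟩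
  · exact le_trans hW1 (Nat.le_mul_of_pos_right _ hpos)
  · rw [Nat.cast_mul]
    have hW0' : (0 : ℝ) ≤ (wCut k B : ℝ) := Nat.cast_nonneg _
    exact le_trans (mul_le_mul_of_nonneg_left hlt.le hW0') hWR
  · exact Nat.Coprime.mul_left (coprime_wCut_self k B) (Nat.Coprime.coprime_mul_left_right hcop)

/-- **The first factor** — the trivial bound: `∑_{q'} τ(q')² E*_{Wq'} ≤ 3#𝒜(X) (e⁵ log⌊R²⌋)^{16(k+1)²}`
(`τ(q') ≤ (4(k+1))^{ω(q')}`, `E*_{Wq'} ≤ 3#𝒜(X)/φ(Wq') ≤ 3#𝒜(X)/φ(q')`, the divisor sum over squarefree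
`q' ≤ R²`). [cite: Maynard2016DenseClusters, proof of Prop. 9.1 p. 19 («E_q ≪ #𝒜(x)/q for the first sum … ∑_{q<R²W} μ²(q)τ_{3k}(q)²/q»)] -/
theorem sum_image_sq_card_mul_errStar_le {L : Fin k → ℤ × ℤ} (hadm : FormsAdmissible L) {B : ℕ}
    {X R : ℝ} (hR : 2 ≤ R) (m : Fin k) (a : ℕ → ℕ)
    (hqA : ∀ pr ∈ crossPairSet L B R, ((wCut k B * ∏ i, Nat.lcm (pr.1 i) (pr.2 i) : ℕ) : ℝ) ≤ #(dyadZ X)) :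
    ∑ q ∈ (crossPairSet L B R).image (fun pr => ∏ i, Nat.lcm (pr.1 i) (pr.2 i)),
        (#((crossPairSet L B R).filter fun pr => ∏ i, Nat.lcm (pr.1 i) (pr.2 i) = q) : ℝ) ^ 2 *
          errStar (L m) X a (wCut k B * q) ≤
      3 * (#(dyadZ X) : ℝ) * (Real.exp 5 * Real.log (⌊R ^ 2⌋₊ : ℕ)) ^ ((4 * (k + 1)) ^ 2) := by
  classical
  have ha0 : (L m).1 ≠ 0 := hadm.1 m
  have hW0 : wCut k B ≠ 0 := (squarefree_wCut k B).ne_zero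
  have hWpos : 0 < wCut k B := Nat.pos_of_ne_zero hW0
  set T := crossPairSet L B R with hT
  have hTf : ∀ pr ∈ T, Squarefree (∏ i, pr.1 i) ∧ Squarefree (∏ i, pr.2 i) ∧
      ∀ i j, i ≠ j → (pr.1 i * pr.2 i).Coprime (pr.1 j * pr.2 j) := fun pr hpr => by
    obtain ⟨hd, he, hx, -⟩ := crossPairSet_facts hpr
    exact ⟨squarefree_of_mem_dkBox hd, squarefree_of_mem_dkBox he, hx⟩
  have hN : 2 ≤ ⌊R ^ 2⌋₊ := by
    refine Nat.le_floor ?_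
    push_cast
    nlinarith
  have hS : ∀ q ∈ T.image (fun pr => ∏ i, Nat.lcm (pr.1 i) (pr.2 i)),
      Squarefree q ∧ q ≤ ⌊R ^ 2⌋₊ := by
    intro q hq
    obtain ⟨pr, hpr, rfl⟩ := Finset.mem_image.1 hq
    obtain ⟨hd, he, hx, -, hlt, -⟩ := crossPairSet_facts hpr
    exact ⟨squarefree_prodLcm (squarefree_of_mem_dkBox hd) (squarefree_of_mem_dkBox he) hx,
      Nat.le_floor hlt.le⟩
  have hA0 : (0 : ℝ) ≤ #(dyadZ X) := Nat.cast_nonneg _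
  have hterm : ∀ q ∈ T.image (fun pr => ∏ i, Nat.lcm (pr.1 i) (pr.2 i)),
      (#(T.filter fun pr => ∏ i, Nat.lcm (pr.1 i) (pr.2 i) = q) : ℝ) ^ 2 *
          errStar (L m) X a (wCut k B * q) ≤
        3 * (#(dyadZ X) : ℝ) *
          ((((4 * (k + 1)) ^ 2 : ℕ) : ℝ) ^ q.primeFactors.card / (Nat.totient q : ℝ)) := by
    intro q hq
    obtain ⟨pr, hpr, rfl⟩ := Finset.mem_image.1 hq
    obtain ⟨hd, he, hx, hpos, hlt, hcop⟩ := crossPairSet_facts hpr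
    have hq0 : (∏ i, Nat.lcm (pr.1 i) (pr.2 i)) ≠ 0 := hpos.ne'
    have hτ : (#(T.filter fun pr' => ∏ i, Nat.lcm (pr'.1 i) (pr'.2 i) =
        ∏ i, Nat.lcm (pr.1 i) (pr.2 i)) : ℝ) ≤
        (4 * ((k : ℝ) + 1)) ^ (∏ i, Nat.lcm (pr.1 i) (pr.2 i)).primeFactors.card := by
      exact_mod_cast card_fibre_prodLcm_le T hTf hq0
    have hE : errStar (L m) X a (wCut k B * ∏ i, Nat.lcm (pr.1 i) (pr.2 i)) ≤
        3 * (#(dyadZ X) : ℝ) / Nat.totient (wCut k B * ∏ i, Nat.lcm (pr.1 i) (pr.2 i)) :=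
      errStar_le_three_mul_div_totient (L m) ha0 X a (Nat.mul_pos hWpos hpos) (hqA pr hpr)
    have hcopW : (wCut k B).Coprime (∏ i, Nat.lcm (pr.1 i) (pr.2 i)) :=
      (Nat.Coprime.coprime_mul_right_right hcop).symm
    have hφ0 : (0 : ℝ) < Nat.totient (∏ i, Nat.lcm (pr.1 i) (pr.2 i)) := by
      exact_mod_cast Nat.totient_pos.2 hpos
    have hφ : (Nat.totient (∏ i, Nat.lcm (pr.1 i) (pr.2 i)) : ℝ) ≤
        Nat.totient (wCut k B * ∏ i, Nat.lcm (pr.1 i) (pr.2 i)) := by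
      rw [Nat.totient_mul hcopW]
      exact_mod_cast Nat.le_mul_of_pos_left _ (Nat.totient_pos.2 hWpos)
    have hc0 : (0 : ℝ) ≤ (4 * ((k : ℝ) + 1)) ^ (∏ i, Nat.lcm (pr.1 i) (pr.2 i)).primeFactors.card :=
      by positivity
    calc (#(T.filter fun pr' => ∏ i, Nat.lcm (pr'.1 i) (pr'.2 i) =
            ∏ i, Nat.lcm (pr.1 i) (pr.2 i)) : ℝ) ^ 2 *
          errStar (L m) X a (wCut k B * ∏ i, Nat.lcm (pr.1 i) (pr.2 i))
        ≤ ((4 * ((k : ℝ) + 1)) ^ (∏ i, Nat.lcm (pr.1 i) (pr.2 i)).primeFactors.card) ^ 2 *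
            (3 * (#(dyadZ X) : ℝ) / Nat.totient (wCut k B * ∏ i, Nat.lcm (pr.1 i) (pr.2 i))) :=
          mul_le_mul (pow_le_pow_left₀ (Nat.cast_nonneg _) hτ 2) hE (errStar_nonneg _ _ _ _)
            (by positivity)
      _ ≤ ((4 * ((k : ℝ) + 1)) ^ (∏ i, Nat.lcm (pr.1 i) (pr.2 i)).primeFactors.card) ^ 2 *
            (3 * (#(dyadZ X) : ℝ) / Nat.totient (∏ i, Nat.lcm (pr.1 i) (pr.2 i))) :=
          mul_le_mul_of_nonneg_left (div_le_div_of_nonneg_left (by positivity) hφ0 hφ)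
            (by positivity)
      _ = 3 * (#(dyadZ X) : ℝ) * ((((4 * (k + 1)) ^ 2 : ℕ) : ℝ) ^
            (∏ i, Nat.lcm (pr.1 i) (pr.2 i)).primeFactors.card /
              (Nat.totient (∏ i, Nat.lcm (pr.1 i) (pr.2 i)) : ℝ)) := by
          push_cast
          rw [← pow_mul, mul_comm _ 2, pow_mul]
          ring
  refine (Finset.sum_le_sum hterm).trans ?_
  rw [← Finset.mul_sum]
  exact mul_le_mul_of_nonneg_left (sum_natPow_omega_div_totient_le ((4 * (k + 1)) ^ 2) hN hS)
    (by positivity)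

/-! ### The regime `k ≤ (log x)^{1/5}`, `x/2 ≤ X`, `X^{1/30} ≤ R ≤ X^{1/9}` -/

/-- Numerical facts of the regime: `X ≥ 3`, `log X ≥ 2e⁵`, `k² ≤ log X`, `R ≥ 3`, `log R ≤ log X`,
`4^{2k²} R² ≤ X^{1/3}` (so `W∏[dᵢ,eᵢ] ≤ WR² ≤ X^{1/3}`), `2X^{1/3} ≤ X`.
[cite: FordGreenKonyaginMaynardTao2018, Thm 6 p. 21 (the ranges of k, X, R); Maynard2016DenseClusters, proof of Prop. 9.1 p. 19 («R²W < x^θ»)] -/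
theorem eventually_prop92err_aux :
    ∀ᶠ x : ℕ in atTop, ∀ k : ℕ, (k : ℝ) ≤ Real.log x ^ ((1 : ℝ) / 5) → ∀ X R : ℝ,
      (x : ℝ) / 2 ≤ X → X ^ ((1 : ℝ) / 30) ≤ R → R ≤ X ^ ((1 : ℝ) / 9) →
        3 ≤ X ∧ 2 * Real.exp 5 ≤ Real.log X ∧ (k : ℝ) ^ 2 ≤ Real.log X ∧ 3 ≤ R ∧
          Real.log R ≤ Real.log X ∧ (4 : ℝ) ^ (2 * k ^ 2) * R ^ 2 ≤ X ^ ((1 : ℝ) / 3) ∧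
          2 * X ^ ((1 : ℝ) / 3) ≤ X := by
  have hH : Tendsto (fun x : ℕ => (x : ℝ) / 2) atTop atTop :=
    tendsto_natCast_atTop_atTop.atTop_div_const (by norm_num)
  have hP : Tendsto (fun x : ℕ => ((x : ℝ) / 2) ^ ((1 : ℝ) / 30)) atTop atTop :=
    (tendsto_rpow_atTop (by norm_num)).comp hH
  have hQ : Tendsto (fun x : ℕ => ((x : ℝ) / 2) ^ ((91 : ℝ) / 900)) atTop atTop :=
    (tendsto_rpow_atTop (by norm_num)).comp hH
  have hQ' : Tendsto (fun x : ℕ => ((x : ℝ) / 2) ^ ((2 : ℝ) / 3)) atTop atTop :=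
    (tendsto_rpow_atTop (by norm_num)).comp hH
  filter_upwards [hH.eventually_ge_atTop (Real.exp (2 * Real.exp 5)), hH.eventually_ge_atTop 4,
    hP.eventually_ge_atTop 3, hQ.eventually_ge_atTop 2, hQ'.eventually_ge_atTop 2,
    eventually_ge_atTop 16, eventually_four_pow_le_rpow (ε := (1 : ℝ) / 100) (by norm_num)]
    with x hxE hx4 hx3 hx2 hx23 hx16 h4 k hk X R hX hR hR9
  have hx16' : (16 : ℝ) ≤ x := by exact_mod_cast hx16
  have hX4 : 4 ≤ X := hx4.trans hX
  have hX0 : 0 < X := by linarith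
  have hX1 : 1 ≤ X := by linarith
  have hx0 : (0 : ℝ) ≤ (x : ℝ) / 2 := by positivity
  -- log X ≥ 2e⁵
  have hlogX : 2 * Real.exp 5 ≤ Real.log X := by
    rw [Real.le_log_iff_exp_le hX0]
    exact hxE.trans hX
  have he5 : (1 : ℝ) ≤ Real.exp 5 := Real.one_le_exp (by norm_num)
  have hlogX1 : 1 ≤ Real.log X := by linarith
  -- k² ≤ log X
  have hlogx0 : 0 ≤ Real.log x := Real.log_nonneg (by linarith)
  have hk5 : (k : ℝ) ^ 5 ≤ Real.log x := by
    have h := pow_le_pow_left₀ (Nat.cast_nonneg k) hk 5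
    rwa [← Real.rpow_natCast ((Real.log x) ^ ((1 : ℝ) / 5)) 5, ← Real.rpow_mul hlogx0,
      show (1 : ℝ) / 5 * ((5 : ℕ) : ℝ) = 1 by norm_num, Real.rpow_one] at h
  have hlogxX : Real.log x - Real.log 2 ≤ Real.log X := by
    have hx0' : (0 : ℝ) < x := by linarith
    rw [← Real.log_div hx0'.ne' (by norm_num)]
    exact Real.log_le_log (by positivity) hX
  have hlog2 : Real.log 2 ≤ Real.log x / 2 := by
    have h16 : Real.log 16 ≤ Real.log x := Real.log_le_log (by norm_num) hx16'
    have : Real.log 16 = 4 * Real.log 2 := by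
      rw [show (16 : ℝ) = 2 ^ 4 by norm_num, Real.log_pow]; norm_num
    have h2 : 0 ≤ Real.log 2 := Real.log_nonneg (by norm_num)
    linarith
  have hksq : (k : ℝ) ^ 2 ≤ Real.log X := by
    rcases Nat.lt_or_ge k 2 with hk1 | hk2
    · have : (k : ℝ) ≤ 1 := by exact_mod_cast Nat.lt_succ_iff.1 hk1
      have hk0 : (0 : ℝ) ≤ k := Nat.cast_nonneg k
      nlinarith
    · have hk2' : (2 : ℝ) ≤ k := by exact_mod_cast hk2
      have h8 : (k : ℝ) ^ 2 * 8 ≤ (k : ℝ) ^ 5 := by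
        have : (8 : ℝ) ≤ (k : ℝ) ^ 3 := by
          have := pow_le_pow_left₀ (by norm_num : (0 : ℝ) ≤ 2) hk2' 3
          norm_num at this; linarith
        nlinarith
      nlinarith
  -- R ≥ 3
  have hR3 : 3 ≤ R := by
    refine hx3.trans (le_trans ?_ hR)
    exact Real.rpow_le_rpow hx0 hX (by norm_num)
  have hR0 : 0 < R := by linarith
  -- log R ≤ log X
  have hRX : R ≤ X := hR9.trans (by
    have := Real.rpow_le_rpow_of_exponent_le hX1 (show (1 : ℝ) / 9 ≤ 1 by norm_num)
    rwa [Real.rpow_one] at this)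
  have hlogR : Real.log R ≤ Real.log X := Real.log_le_log hR0 hRX
  -- 4^{2k²} R² ≤ X^{1/3}
  have hx2X : (x : ℝ) ≤ 2 * X := by linarith
  have h4' : (4 : ℝ) ^ (2 * k ^ 2) ≤ 2 * X ^ ((1 : ℝ) / 100) := by
    refine (h4 k hk).trans ?_
    calc (x : ℝ) ^ ((1 : ℝ) / 100) ≤ (2 * X) ^ ((1 : ℝ) / 100) :=
          Real.rpow_le_rpow (by positivity) hx2X (by norm_num)
      _ = (2 : ℝ) ^ ((1 : ℝ) / 100) * X ^ ((1 : ℝ) / 100) :=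
          Real.mul_rpow (by norm_num) hX0.le
      _ ≤ 2 * X ^ ((1 : ℝ) / 100) := by
          refine mul_le_mul_of_nonneg_right ?_ (by positivity)
          have := Real.rpow_le_rpow_of_exponent_le (show (1 : ℝ) ≤ 2 by norm_num)
            (show (1 : ℝ) / 100 ≤ 1 by norm_num)
          rwa [Real.rpow_one] at this
  have hR2 : R ^ 2 ≤ X ^ ((2 : ℝ) / 9) := by
    calc R ^ 2 ≤ (X ^ ((1 : ℝ) / 9)) ^ 2 := pow_le_pow_left₀ hR0.le hR9 2
      _ = X ^ ((2 : ℝ) / 9) := by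
          rw [← Real.rpow_natCast, ← Real.rpow_mul hX0.le]; norm_num
  have hX91 : 2 ≤ X ^ ((91 : ℝ) / 900) :=
    hx2.trans (Real.rpow_le_rpow hx0 hX (by norm_num))
  have hWR : (4 : ℝ) ^ (2 * k ^ 2) * R ^ 2 ≤ X ^ ((1 : ℝ) / 3) := by
    have e : X ^ ((1 : ℝ) / 3) = X ^ ((1 : ℝ) / 100) * X ^ ((2 : ℝ) / 9) * X ^ ((91 : ℝ) / 900) := by
      rw [← Real.rpow_add hX0, ← Real.rpow_add hX0]; norm_num
    rw [e]
    have h1 : (0 : ℝ) ≤ X ^ ((1 : ℝ) / 100) := by positivity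
    have h2 : (0 : ℝ) ≤ X ^ ((2 : ℝ) / 9) := by positivity
    calc (4 : ℝ) ^ (2 * k ^ 2) * R ^ 2 ≤ (2 * X ^ ((1 : ℝ) / 100)) * X ^ ((2 : ℝ) / 9) :=
          mul_le_mul h4' hR2 (sq_nonneg R) (by positivity)
      _ = X ^ ((1 : ℝ) / 100) * X ^ ((2 : ℝ) / 9) * 2 := by ring
      _ ≤ X ^ ((1 : ℝ) / 100) * X ^ ((2 : ℝ) / 9) * X ^ ((91 : ℝ) / 900) :=
          mul_le_mul_of_nonneg_left hX91 (mul_nonneg h1 h2)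
  -- 2 X^{1/3} ≤ X
  have hX23 : 2 ≤ X ^ ((2 : ℝ) / 3) := hx23.trans (Real.rpow_le_rpow hx0 hX (by norm_num))
  have hX13 : 2 * X ^ ((1 : ℝ) / 3) ≤ X := by
    have e : X = X ^ ((1 : ℝ) / 3) * X ^ ((2 : ℝ) / 3) := by
      rw [← Real.rpow_add hX0]; norm_num
    have h1 : (0 : ℝ) ≤ X ^ ((1 : ℝ) / 3) := by positivity
    calc 2 * X ^ ((1 : ℝ) / 3) = X ^ ((1 : ℝ) / 3) * 2 := mul_comm _ _
      _ ≤ X ^ ((1 : ℝ) / 3) * X ^ ((2 : ℝ) / 3) := mul_le_mul_of_nonneg_left hX23 h1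
      _ = X := e.symm
  exact ⟨by linarith, hlogX, hksq, hR3, hlogR, hWR, hX13⟩

/-! ### The final numerical inequality -/

/-- `4^{2k²} y^{2k + 8(k+1)²} ≤ ℓ^{39k²}` for `16 ≤ ℓ`, `0 ≤ y ≤ ℓ²`, `k ≥ 2`. [folklore] -/
private theorem arith_pow_le {k : ℕ} (hk : 2 ≤ k) {ℓ y : ℝ} (hℓ : 16 ≤ ℓ) (hy0 : 0 ≤ y)
    (hy : y ≤ ℓ ^ 2) :
    (4 : ℝ) ^ (2 * k ^ 2) * y ^ (2 * k + 8 * (k + 1) ^ 2) ≤ ℓ ^ (39 * k ^ 2) := by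
  have hℓ1 : 1 ≤ ℓ := by linarith
  have h1 : (4 : ℝ) ^ (2 * k ^ 2) ≤ ℓ ^ (k ^ 2) := by
    rw [pow_mul]
    exact pow_le_pow_left₀ (by norm_num) (by norm_num; linarith) _
  have h2 : y ^ (2 * k + 8 * (k + 1) ^ 2) ≤ ℓ ^ (2 * (2 * k + 8 * (k + 1) ^ 2)) := by
    rw [pow_mul]
    exact pow_le_pow_left₀ hy0 hy _
  have hexp : k ^ 2 + 2 * (2 * k + 8 * (k + 1) ^ 2) ≤ 39 * k ^ 2 := by nlinarith
  calc (4 : ℝ) ^ (2 * k ^ 2) * y ^ (2 * k + 8 * (k + 1) ^ 2)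
      ≤ ℓ ^ (k ^ 2) * ℓ ^ (2 * (2 * k + 8 * (k + 1) ^ 2)) :=
        mul_le_mul h1 h2 (by positivity) (by positivity)
    _ = ℓ ^ (k ^ 2 + 2 * (2 * k + 8 * (k + 1) ^ 2)) := (pow_add _ _ _).symm
    _ ≤ ℓ ^ (39 * k ^ 2) := pow_le_pow_right₀ hℓ1 hexp

/-- `e^{7k} (2k log k)^k ≤ ℓ^{11k²}` for `e ≤ ℓ`, `k² ≤ ℓ`, `k ≥ 2`. [folklore] -/
private theorem arith_exp_mul_le {k : ℕ} (hk : 2 ≤ k) {ℓ : ℝ} (hℓe : Real.exp 1 ≤ ℓ)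
    (hkℓ : (k : ℝ) ^ 2 ≤ ℓ) :
    Real.exp (7 * k) * (2 * (k : ℝ) * Real.log k) ^ k ≤ ℓ ^ (11 * k ^ 2) := by
  have hk2 : (2 : ℝ) ≤ k := by exact_mod_cast hk
  have hℓ2 : 2 ≤ ℓ := le_trans (by have := Real.add_one_le_exp (1 : ℝ); linarith) hℓe
  have hℓ1 : 1 ≤ ℓ := by linarith
  have hlogk : Real.log k ≤ k := Real.log_le_self (by linarith)
  have hlogk0 : 0 ≤ Real.log k := Real.log_nonneg (by linarith)
  have h1 : Real.exp (7 * k) ≤ ℓ ^ (4 * k ^ 2) := by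
    have e : Real.exp (7 * k) = Real.exp 1 ^ (7 * k) := by
      rw [← Real.exp_nat_mul 1 (7 * k)]; push_cast; ring_nf
    rw [e]
    calc Real.exp 1 ^ (7 * k) ≤ ℓ ^ (7 * k) := pow_le_pow_left₀ (Real.exp_pos 1).le hℓe _
      _ ≤ ℓ ^ (4 * k ^ 2) := pow_le_pow_right₀ hℓ1 (by nlinarith)
  have h2 : (2 * (k : ℝ) * Real.log k) ^ k ≤ ℓ ^ (k ^ 2) := by
    have hb : 2 * (k : ℝ) * Real.log k ≤ ℓ ^ 2 := by
      calc 2 * (k : ℝ) * Real.log k ≤ 2 * (k : ℝ) * k :=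
            mul_le_mul_of_nonneg_left hlogk (by positivity)
        _ = 2 * (k : ℝ) ^ 2 := by ring
        _ ≤ ℓ * ℓ := mul_le_mul hℓ2 hkℓ (by positivity) (by linarith)
        _ = ℓ ^ 2 := (sq ℓ).symm
    calc (2 * (k : ℝ) * Real.log k) ^ k ≤ (ℓ ^ 2) ^ k := pow_le_pow_left₀ (by positivity) hb k
      _ = ℓ ^ (2 * k) := (pow_mul ℓ 2 k).symm
      _ ≤ ℓ ^ (k ^ 2) := pow_le_pow_right₀ hℓ1 (by nlinarith)
  calc Real.exp (7 * k) * (2 * (k : ℝ) * Real.log k) ^ k ≤ ℓ ^ (4 * k ^ 2) * ℓ ^ (k ^ 2) :=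
        mul_le_mul h1 h2 (by positivity) (by positivity)
    _ = ℓ ^ (5 * k ^ 2) := by rw [← pow_add]; ring_nf
    _ ≤ ℓ ^ (11 * k ^ 2) := pow_le_pow_right₀ hℓ1 (by nlinarith)

/-- **The numerical heart of the error estimate**: with `Λ = 2(2e⁵r)^k` (`r = log R`), `φ_ω(W) ≤ 4^{2k²}`,
`S₁ ≤ 3A(2e⁵r)^{16(k+1)²}`, `S₂ ≤ C_H P/ℓ^{100k²}` (`ℓ = log X ≥ 2e⁵`, `k² ≤ ℓ`, `1 ≤ r ≤ ℓ`), the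
bound `Λ²φ_ω(W)√S₁√S₂ ≤ 4√(3C_H) A ℓ^{−11k²} ≤ 4√(3C_H)K₈ · (b^k 𝔖 A r^{k−1} I_k)` whenever
`𝔖 ≥ e^{−7k}`, `b ≥ 1`, `(2k log k)^{−k} ≤ K₈ I_k`.
[cite: Maynard2016DenseClusters, proof of Prop. 9.1 p. 19 («≪ #𝒜(x)/(W(log x)^{2k²})»), proof of Prop. 9.2 p. 21, Lemmas 8.1 and 8.6 pp. 15–18] -/
theorem prop92err_arith {k : ℕ} (hk : 2 ≤ k) {ℓ r A P CH K₈ IF SB b φW S₁ S₂ T : ℝ}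
    (hℓ : 2 * Real.exp 5 ≤ ℓ) (hr1 : 1 ≤ r) (hrℓ : r ≤ ℓ) (hkℓ : (k : ℝ) ^ 2 ≤ ℓ)
    (hA : 0 ≤ A) (hPA : P ≤ A) (hCH : 0 < CH) (hK₈ : 0 < K₈)
    (hIF : (2 * (k : ℝ) * Real.log k) ^ (-(k : ℝ)) ≤ K₈ * IF) (hIF0 : 0 < IF)
    (hSB : Real.exp (-(7 * (k : ℝ))) ≤ SB) (hb : 1 ≤ b)
    (hφW : φW ≤ (4 : ℝ) ^ (2 * k ^ 2))
    (hS₁ : S₁ ≤ 3 * A * (2 * Real.exp 5 * r) ^ ((4 * (k + 1)) ^ 2))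
    (hS₂ : S₂ ≤ CH * P / ℓ ^ (100 * k ^ 2))
    (hT0 : 0 ≤ T) (hT : T ≤ Real.sqrt S₁ * Real.sqrt S₂) :
    (2 * (2 * Real.exp 5 * r) ^ k) ^ 2 * φW * T ≤
      4 * Real.sqrt (3 * CH) * K₈ * (b ^ k * SB * A * r ^ (k - 1) * IF) := by
  have hk2 : (2 : ℝ) ≤ k := by exact_mod_cast hk
  have he5 : (1 : ℝ) ≤ Real.exp 5 := Real.one_le_exp (by norm_num)
  have he1 : Real.exp 1 ≤ ℓ :=
    le_trans (by linarith [Real.exp_le_exp.2 (show (1 : ℝ) ≤ 5 by norm_num)]) hℓ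
  have hℓ16 : 16 ≤ ℓ := by
    have : (8 : ℝ) ≤ Real.exp 5 := by
      have h1 : (2.7182818283 : ℝ) ≤ Real.exp 1 := Real.exp_one_gt_d9.le
      have h2 := pow_le_pow_left₀ (by norm_num) h1 5
      rw [← Real.exp_nat_mul 1 5] at h2
      norm_num at h2
      linarith
    linarith
  have hℓ1 : 1 ≤ ℓ := by linarith
  have hℓ0 : 0 < ℓ := by linarith
  set y := 2 * Real.exp 5 * r with hy
  have hy0 : 0 ≤ y := by positivity
  have hyℓ : y ≤ ℓ ^ 2 := by
    calc y = (2 * Real.exp 5) * r := by rw [hy]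
      _ ≤ ℓ * ℓ := mul_le_mul hℓ hrℓ (by linarith) hℓ0.le
      _ = ℓ ^ 2 := (sq ℓ).symm
  -- √S₁ ≤ √(3A) y^{8(k+1)²}
  have hm : (4 * (k + 1)) ^ 2 = 2 * (8 * (k + 1) ^ 2) := by ring
  have hsq1 : Real.sqrt S₁ ≤ Real.sqrt (3 * A) * y ^ (8 * (k + 1) ^ 2) := by
    have h : S₁ ≤ 3 * A * (y ^ (8 * (k + 1) ^ 2)) ^ 2 := by
      rw [← pow_mul, mul_comm (8 * (k + 1) ^ 2) 2, ← hm]; exact hS₁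
    calc Real.sqrt S₁ ≤ Real.sqrt (3 * A * (y ^ (8 * (k + 1) ^ 2)) ^ 2) := Real.sqrt_le_sqrt h
      _ = Real.sqrt (3 * A) * y ^ (8 * (k + 1) ^ 2) := by
          rw [Real.sqrt_mul (by positivity), Real.sqrt_sq (by positivity)]
  -- √S₂ ≤ √(CH A)/ℓ^{50k²}
  have hsq2 : Real.sqrt S₂ ≤ Real.sqrt (CH * A) / ℓ ^ (50 * k ^ 2) := by
    have h : S₂ ≤ CH * A / (ℓ ^ (50 * k ^ 2)) ^ 2 := by
      rw [← pow_mul, mul_comm (50 * k ^ 2) 2, show 2 * (50 * k ^ 2) = 100 * k ^ 2 by ring]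
      exact hS₂.trans (div_le_div_of_nonneg_right (mul_le_mul_of_nonneg_left hPA hCH.le)
        (by positivity))
    calc Real.sqrt S₂ ≤ Real.sqrt (CH * A / (ℓ ^ (50 * k ^ 2)) ^ 2) := Real.sqrt_le_sqrt h
      _ = Real.sqrt (CH * A) / ℓ ^ (50 * k ^ 2) := by
          rw [Real.sqrt_div' _ (by positivity), Real.sqrt_sq (by positivity)]
  -- the left side ≤ 4√(3CH) A ℓ^{39k²}/ℓ^{50k²}
  have hΛ2 : (2 * y ^ k) ^ 2 = 4 * y ^ (2 * k) := by rw [mul_pow, ← pow_mul, mul_comm k 2]; norm_num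
  have hsqA : Real.sqrt (3 * A) * Real.sqrt (CH * A) = Real.sqrt (3 * CH) * A := by
    rw [← Real.sqrt_mul (by positivity), show 3 * A * (CH * A) = 3 * CH * A ^ 2 by ring,
      Real.sqrt_mul (by positivity), Real.sqrt_sq hA]
  have hL : (2 * y ^ k) ^ 2 * φW * T ≤
      4 * Real.sqrt (3 * CH) * A * (ℓ ^ (39 * k ^ 2) / ℓ ^ (50 * k ^ 2)) := by
    have hT' : T ≤ (Real.sqrt (3 * A) * y ^ (8 * (k + 1) ^ 2)) *
        (Real.sqrt (CH * A) / ℓ ^ (50 * k ^ 2)) :=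
      hT.trans (mul_le_mul hsq1 hsq2 (Real.sqrt_nonneg _) (by positivity))
    have hpow := arith_pow_le hk hℓ16 hy0 hyℓ
    calc (2 * y ^ k) ^ 2 * φW * T
        ≤ (4 * y ^ (2 * k)) * (4 : ℝ) ^ (2 * k ^ 2) * ((Real.sqrt (3 * A) * y ^ (8 * (k + 1) ^ 2)) *
            (Real.sqrt (CH * A) / ℓ ^ (50 * k ^ 2))) := by
          rw [hΛ2]
          exact mul_le_mul (mul_le_mul_of_nonneg_left hφW (by positivity)) hT' hT0 (by positivity)
      _ = 4 * (Real.sqrt (3 * A) * Real.sqrt (CH * A)) *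
            (((4 : ℝ) ^ (2 * k ^ 2) * y ^ (2 * k + 8 * (k + 1) ^ 2)) / ℓ ^ (50 * k ^ 2)) := by
          rw [pow_add]; ring
      _ ≤ 4 * (Real.sqrt (3 * A) * Real.sqrt (CH * A)) * (ℓ ^ (39 * k ^ 2) / ℓ ^ (50 * k ^ 2)) :=
          mul_le_mul_of_nonneg_left (div_le_div_of_nonneg_right hpow (by positivity))
            (by positivity)
      _ = 4 * Real.sqrt (3 * CH) * A * (ℓ ^ (39 * k ^ 2) / ℓ ^ (50 * k ^ 2)) := by
          rw [hsqA]; ring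
  -- ℓ^{39k²}/ℓ^{50k²} ≤ e^{-7k} (2k log k)^{-k} ≤ SB · K₈ IF
  have hbase : 0 < 2 * (k : ℝ) * Real.log k := by
    have : 0 < Real.log k := Real.log_pos (by linarith)
    positivity
  have hratio : ℓ ^ (39 * k ^ 2) / ℓ ^ (50 * k ^ 2) ≤
      Real.exp (-(7 * (k : ℝ))) * (2 * (k : ℝ) * Real.log k) ^ (-(k : ℝ)) := by
    have e1 : ℓ ^ (39 * k ^ 2) / ℓ ^ (50 * k ^ 2) = 1 / ℓ ^ (11 * k ^ 2) := by
      rw [show 50 * k ^ 2 = 39 * k ^ 2 + 11 * k ^ 2 by ring, pow_add,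
        div_mul_eq_div_div, div_self (by positivity)]
    have e2 : Real.exp (-(7 * (k : ℝ))) * (2 * (k : ℝ) * Real.log k) ^ (-(k : ℝ)) =
        1 / (Real.exp (7 * k) * (2 * (k : ℝ) * Real.log k) ^ k) := by
      rw [Real.exp_neg, Real.rpow_neg hbase.le, Real.rpow_natCast]
      field_simp
    rw [e1, e2]
    exact one_div_le_one_div_of_le (by positivity) (arith_exp_mul_le hk he1 hkℓ)
  have hfin : Real.exp (-(7 * (k : ℝ))) * (2 * (k : ℝ) * Real.log k) ^ (-(k : ℝ)) ≤
      SB * (K₈ * IF) := mul_le_mul hSB hIF (Real.rpow_nonneg hbase.le _) (le_trans (Real.exp_pos _).le hSB)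
  have hbk : 1 ≤ b ^ k := one_le_pow₀ hb
  have hbk0 : 0 ≤ b ^ k := le_trans zero_le_one hbk
  have hrk : 1 ≤ r ^ (k - 1) := one_le_pow₀ hr1
  have hSB0 : 0 ≤ SB := le_trans (Real.exp_pos _).le hSB
  have h4 : 0 ≤ 4 * Real.sqrt (3 * CH) := by positivity
  calc (2 * y ^ k) ^ 2 * φW * T ≤ 4 * Real.sqrt (3 * CH) * A * (ℓ ^ (39 * k ^ 2) / ℓ ^ (50 * k ^ 2)) := hL
    _ ≤ 4 * Real.sqrt (3 * CH) * A * (SB * (K₈ * IF)) :=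
        mul_le_mul_of_nonneg_left (hratio.trans hfin) (mul_nonneg h4 hA)
    _ = 4 * Real.sqrt (3 * CH) * K₈ * (1 * SB * A * 1 * IF) := by ring
    _ ≤ 4 * Real.sqrt (3 * CH) * K₈ * (b ^ k * SB * A * r ^ (k - 1) * IF) := by
        refine mul_le_mul_of_nonneg_left ?_ (mul_nonneg h4 hK₈.le)
        refine mul_le_mul_of_nonneg_right ?_ hIF0.le
        refine mul_le_mul ?_ hrk zero_le_one (mul_nonneg (mul_nonneg hbk0 hSB0) hA)
        exact mul_le_mul_of_nonneg_right (mul_le_mul_of_nonneg_right hbk hSB0) hA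

end FGKMT2018

/-! ### Assembly -/

set_option maxHeartbeats 400000 in
open FGKMT2018 in
/-- **Proposition 9.2 of [Maynard 2016] over `𝒜 = ℤ` — the error part**: in the frame of [FGKMT, Thm 6],
for `(a_m, B) = 1`, `L_m(n) > R` on `𝒜(X)` and Hypothesis 1 (2) at level `X^{1/3}`,
`|∑_{n ∈ 𝒜(X)} 1_𝒫(L_m(n)) w_n − φ_ω(W) (#𝒫_{L_m}(X)/φ_{L_m}(W)) Q_m| ≤ K · errTermB`.
[cite: Maynard2016DenseClusters, proof of Prop. 9.2 p. 21 («these error terms contribute a total of O(#𝒜(x)/(W(log x)^{2k²})), which is negligible»); FordGreenKonyaginMaynardTao2018, Thm 6 (7.12) pp. 21–22] -/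
theorem maynard2016Prop92ErrorPart_holds : Maynard2016Prop92ErrorPart := by
  classical
  intro C_H hC_H
  obtain ⟨C₀, K₈, hK₈, h0⟩ := MaynardDense.exists_IF_JF_bounds
  refine ⟨max C₀ 2, 4 * Real.sqrt (3 * C_H) * K₈ + 1, by positivity, ?_⟩
  have h85 := maynard_lemma85i_frame
  unfold Prop61Frame at h85 ⊢
  filter_upwards [h85, eventually_prop92err_aux] with x hx haux B hB hBx k L X R hCk hk hadm hnd
    hcoef hX1 hX2 hR1 hR2 m ham hRm hHyp
  have hC₀k : C₀ ≤ k := le_trans (le_max_left _ _) hCk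
  have hk2 : 2 ≤ k := le_trans (le_max_right _ _) hCk
  have hk1 : 1 ≤ k := le_trans (by norm_num) hk2
  have hΛ := hx B hB hBx k L X R hk2 hk hadm hnd hcoef hX1 hX2 hR1 hR2
  obtain ⟨hX3, hlogX, hksq, hR3, hlogRX, hWR2, hX13⟩ := haux k hk X R hX1 hR1 hR2
  obtain ⟨hIF0, hIF, -, -⟩ := h0 k hC₀k
  have hR1' : 1 < R := by linarith
  have hR0 : 0 < R := by linarith
  have hX0 : 0 < X := by linarith
  have hr1 : 1 ≤ Real.log R := by
    rw [← Real.log_exp 1]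
    refine Real.log_le_log (Real.exp_pos 1) (le_trans ?_ hR3)
    have := Real.exp_one_lt_d9; linarith
  obtain ⟨a, ha⟩ := exists_classMax (L m) X
  -- Step 0: the exact split
  rw [sum_prime_sieveWt_eq_main_add_error X hadm B (MaynardDense.F k) m hRm, add_sub_cancel_left]
  -- Step 2: `≤ Λ² φ_ω(W) ∑_{pairs} E*`
  have hΛ0 : (0 : ℝ) ≤ 2 * (2 * Real.exp 5 * Real.log R) ^ k := by positivity
  have hE := abs_esum_le X hadm B hR1' m ha hΛ0 hΛ
  -- Step 3: Cauchy–Schwarz over the fibres of `(d,e) ↦ ∏[dᵢ,eᵢ]`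
  have hCS := sum_comp_le_sqrt_mul_sqrt (crossPairSet L B R)
    (fun pr : (Fin k → ℕ) × (Fin k → ℕ) => ∏ i, Nat.lcm (pr.1 i) (pr.2 i))
    (h := fun q => errStar (L m) X a (wCut k B * q)) (fun q => errStar_nonneg _ _ _ _)
  -- Step 4: the second factor (Hypothesis 1)
  have hWR : (wCut k B : ℝ) * R ^ 2 ≤ X ^ ((1 : ℝ) / 3) :=
    le_trans (mul_le_mul_of_nonneg_right (by exact_mod_cast wCut_le_four_pow k B) (sq_nonneg R))
      hWR2
  have hS₂ := sum_image_errStar_le_hyp m a hHyp hWR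
  -- Step 5: the first factor (trivial bound)
  have hA1 : X - 1 ≤ (#(dyadZ X) : ℝ) := (card_dyadZ_bounds hX0.le).1
  have hX13' : X ^ ((1 : ℝ) / 3) ≤ X - 1 := by
    have : (1 : ℝ) ≤ X ^ ((1 : ℝ) / 3) := Real.one_le_rpow (by linarith) (by norm_num)
    linarith
  have hqA : ∀ pr ∈ crossPairSet L B R,
      ((wCut k B * ∏ i, Nat.lcm (pr.1 i) (pr.2 i) : ℕ) : ℝ) ≤ #(dyadZ X) := by
    intro pr hpr
    obtain ⟨-, -, -, -, hlt, -⟩ := crossPairSet_facts hpr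
    rw [Nat.cast_mul]
    calc (wCut k B : ℝ) * ((∏ i, Nat.lcm (pr.1 i) (pr.2 i) : ℕ) : ℝ) ≤ (wCut k B : ℝ) * R ^ 2 :=
          mul_le_mul_of_nonneg_left hlt.le (Nat.cast_nonneg _)
      _ ≤ #(dyadZ X) := hWR.trans (hX13'.trans hA1)
  have hS₁ := sum_image_sq_card_mul_errStar_le hadm (show (2 : ℝ) ≤ R by linarith) m a hqA
  have hN2 : Real.exp 5 * Real.log (⌊R ^ 2⌋₊ : ℕ) ≤ 2 * Real.exp 5 * Real.log R := by
    have h1 : ((⌊R ^ 2⌋₊ : ℕ) : ℝ) ≤ R ^ 2 := Nat.floor_le (by positivity)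
    have h2 : (0 : ℝ) < ((⌊R ^ 2⌋₊ : ℕ) : ℝ) := by
      exact_mod_cast Nat.floor_pos.2 (by nlinarith)
    have h3 : Real.log ((⌊R ^ 2⌋₊ : ℕ) : ℝ) ≤ 2 * Real.log R := by
      have h := Real.log_le_log h2 h1
      rw [Real.log_pow] at h; norm_num at h; exact h
    nlinarith [Real.exp_pos (5 : ℝ)]
  have hN0 : 0 ≤ Real.exp 5 * Real.log (⌊R ^ 2⌋₊ : ℕ) := by
    refine mul_nonneg (Real.exp_pos 5).le (Real.log_nonneg ?_)
    have : (1 : ℕ) ≤ ⌊R ^ 2⌋₊ := Nat.le_floor (by push_cast; nlinarith)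
    exact_mod_cast this
  have hS₁' := hS₁.trans (mul_le_mul_of_nonneg_left (pow_le_pow_left₀ hN0 hN2 _) (by positivity))
  -- Step 6: the numbers
  have hPA' : primeCountZ (L m) X ≤ #(dyadZ X) := by
    unfold primeCountZ; exact Finset.card_filter_le _ _
  have hPA : (primeCountZ (L m) X : ℝ) ≤ #(dyadZ X) := by exact_mod_cast hPA'
  have hSB := exp_neg_seven_mul_le_singSeriesExcl hadm hnd hk1 B
  have hb := one_le_bOverPhi hB
  have hT0 : (0 : ℝ) ≤ ∑ pr ∈ crossPairSet L B R, errStar (L m) X a (pairMod B pr.1 pr.2) :=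
    Finset.sum_nonneg fun q _ => errStar_nonneg _ _ _ _
  have hfin := prop92err_arith hk2 hlogX hr1 hlogRX hksq (Nat.cast_nonneg _) hPA
    hC_H hK₈ hIF hIF0 hSB hb (phiOmega_wCut_le_four_pow L B) hS₁' hS₂ hT0 hCS
  have herr0 : 0 ≤ bOverPhi B ^ k * singSeriesExcl L B * (#(dyadZ X) : ℝ) * Real.log R ^ (k - 1) *
      MaynardDense.IF k :=
    mul_nonneg (mul_nonneg (mul_nonneg (mul_nonneg (pow_nonneg (le_trans zero_le_one hb) _)
      (le_trans (Real.exp_pos _).le hSB)) (Nat.cast_nonneg _)) (pow_nonneg (by linarith) _)) hIF0.le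
  have hφ0 : 0 ≤ (2 * (2 * Real.exp 5 * Real.log R) ^ k) ^ 2 * phiOmega L (wCut k B) :=
    mul_nonneg (sq_nonneg _) (phiOmega_wCut_nonneg L B)
  calc _ ≤ (2 * (2 * Real.exp 5 * Real.log R) ^ k) ^ 2 * phiOmega L (wCut k B) *
        ∑ pr ∈ crossPairSet L B R, errStar (L m) X a (pairMod B pr.1 pr.2) := hE
    _ ≤ 4 * Real.sqrt (3 * C_H) * K₈ * (bOverPhi B ^ k * singSeriesExcl L B * (#(dyadZ X) : ℝ) *
        Real.log R ^ (k - 1) * MaynardDense.IF k) := hfin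
    _ ≤ (4 * Real.sqrt (3 * C_H) * K₈ + 1) * (bOverPhi B ^ k * singSeriesExcl L B *
        (#(dyadZ X) : ℝ) * Real.log R ^ (k - 1) * MaynardDense.IF k) :=
      mul_le_mul_of_nonneg_right (by linarith) herr0
    _ = _ := by unfold errTermB; rfl
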